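import Mathlib
import HarnessLib
import Summits.ValiantsHypothesis.ValiantsHypothesis.Theses.MonotoneRestoration
import Literature.Computability.AlgebraicComplexity.ArithCircuit
import Literature.Computability.AlgebraicComplexity.ArithCircuitProofs
import Literature.Computability.AlgebraicComplexity.MonotoneStructure
import Literature.Computability.AlgebraicComplexity.PermanentIrreducible
import Literature.ModelTheory.FiniteModelTheory.CkEquiv
import Summits.ValiantsHypothesis.ValiantsHypothesis.Theorems.MonotoneRestorationMonotoneRestorationQPCosetCount
import Summits.ValiantsHypothesis.ValiantsHypothesis.Theorems.MonotoneRestorationMonotoneRestorationQPSymmetricLB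
import Summits.ValiantsHypothesis.ValiantsHypothesis.Theorems.MonotoneRestorationMonotoneRestorationQPSupportSymmetrisation
import Summits.ValiantsHypothesis.ValiantsHypothesis.Theorems.MonotoneRestorationMonotoneRestorationQPSparseRegime
import Summits.ValiantsHypothesis.ValiantsHypothesis.Theorems.MonotoneRestorationMonotoneRestorationQPBeta
import Literature.Computability.AlgebraicComplexity.SymmetricArithCircuit
import Literature.Computability.AlgebraicComplexity.DawarWilsenach2025Proofs
import Literature.GroupTheory.PermutationGroups.SmallIndexSubgroups
import Summits.ValiantsHypothesis.ValiantsHypothesis.Theorems.MonotoneRestorationQP.Negative.LoadBearing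
import Summits.ValiantsHypothesis.ValiantsHypothesis.Theorems.MonotoneRestorationMonotoneRestorationQPPermSupportCount

/-! TTRL-lite variant V20048 of stmt-ValiantsHypothesis-15886

Variant (move `lemma_proposal`, op `llm`) of the stuck stub `stub_gateSupport` of crux
`MonotoneRestorationQP` (route MonotoneRestoration): the **base case "constants"** of the support
theorem in gate-stabiliser form.  In a `Sym_n`-symmetric labelled arithmetic circuit over the
variables `x_{ij}`, `(i, j) ∈ [n] × [n]`, a gate labelled by a constant `c : K` is fixed by an
automorphic extension of EVERY permutation `ρ` — so its support is `∅`, with no parity condition,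
no size bound and no `n > 8`.  Proof: symmetry (Def. 3.7) supplies an extension `π` of `ρ`, and an
automorphism fixes every constant gate because labels are injective on input gates
(`IsAutomorphismExtending.apply_eq_self_of_label_const`).
-/

-- `Summit.ValiantsHypothesis.ValiantsHypothesis.…` is the tree's mandated single-conjunct layout
-- (Sub = Summit), so the duplicated namespace component is intended.
set_option linter.dupNamespace false

namespace Summit.ValiantsHypothesis.ValiantsHypothesis.Theorems

open Summit.ValiantsHypothesis.ValiantsHypothesis.Theses.MonotoneRestoration
open Literature.Computability.AlgebraicComplexity

/-- **TTRL-lite variant V20048 of stmt-ValiantsHypothesis-15886** (constant gates have empty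
support).  For a `Sym_n`-symmetric labelled arithmetic circuit `C` on the variables indexed by
`[n] × [n]` and a gate `g` labelled `const c`, every `ρ : Equiv.Perm (Fin n)` has an extension to a
circuit automorphism `π` with `π g = g`: symmetry gives the extension, and automorphisms fix constant
gates (`apply_eq_self_of_label_const`). [cite: DawarWilsenach2025, Defs. 3.6–3.7] -/
theorem stub_gatesupport_var20048 :
    ∀ (n : ℕ) (K : Type) (G : Type) (C : LabelledArithCircuit K (Fin n × Fin n) Unit G)
      (hC : C.IsSymmetric (Equiv.Perm (Fin n))) (g : G) (c : K),
      C.label g = CircuitLabel.const c → ∀ ρ : Equiv.Perm (Fin n),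
        ∃ π : Equiv.Perm G, C.IsAutomorphismExtending ρ π ∧ π g = g := by
  intro n K G C hC g c hg ρ
  obtain ⟨π, hπ⟩ := hC ρ
  exact ⟨π, hπ, hπ.apply_eq_self_of_label_const hg⟩

end Summit.ValiantsHypothesis.ValiantsHypothesis.Theorems
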